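import Summits.Ventures.PercRepro.Night2ThreeTwoEight

/-!
# PercRepro — the cell `(3, 2)`: the capacities of the top targets (night-2, gen 27)

The targets missing at most two points of `G` have `cap2 = 1`; those with `|T ∖ K| ≥ n − 1` carry no distance-one load
(a missed source needs `|T ∖ K| + 2 ≤ n`), and those with `|T ∖ K| = n − 2` carry at most
`3/20 + C(n − 2, 2)/198` (at most three fat sources at `1/20` each, at most `C(n − 2, 2)` sources in all at `1/198`).
Gen 26 proved the case `n = 8`; here the same bounds for every `n ≥ 8`, as lower bounds on `cap3`.

* `dload_missed_le_of_top`: `dload ≤ 3/20 + C(s, 2)/198` at `|S ∖ K| = s` (any `s`, `n ≥ 8`);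
* **`one_le_cap3_of_top`**: `cap3 ≥ 1` at `|S ∖ K| ≥ n − 1`;
* **`cap3_ge_of_second`**: `cap3 ≥ 1 − 3/20 − C(n − 2, 2)/198` at `|S ∖ K| = n − 2`.
-/

namespace PercRepro.Shadow

open Finset PerFlat ThmH

variable {α : Type*} [DecidableEq α] {M : Matroid α} [M.Finite]

section TopCaps

variable {G : Finset α}

open scoped Classical in
/-- At every target with `|S ∖ K| = s` of a flat with `|V| ≥ 8`, the distance-one load is at most
`3/20 + C(s, 2)/198`. -/
theorem dload_missed_le_of_top (hG : G ∈ flatsQ M (5 + 1)) (hd : (gr M \ G).card = 3) (hk : kColoops M G = 2)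
    (hs : ∀ e ∈ gr M, ∀ f ∈ gr M, e ≠ f → rkN M {e, f} = 2) (hl : ∀ e ∈ gr M, M.Indep {e})
    (h8 : 8 ≤ (G \ coloops M G).card) {P : Finset α → Prop} [DecidablePred P]
    (hP : ∀ B, P B → 4 ≤ (B \ coloops M G).card) (S : Finset α) :
    dload M 5 G P (dshMissed M 5 G) S ≤ 3 / 20 + (((S \ coloops M G).card.choose 2 : ℕ) : ℚ) / 198 := by
  have hd' : (gr M \ G).card ≤ 5 := by omega
  have hw := dload_missed_le_weighted hG hd hk hs hl hP S
  have hfat := card_fat_sources_le_three hG hd' hk hs h8 (P := P) S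
  have hthree : ((missedSources M 5 G P S).filter (fun B => (G \ clF M B).card = 3)).card ≤
      (S \ coloops M G).card.choose 2 := by
    have h1 := Finset.card_filter_le (missedSources M 5 G P S) (fun B => (G \ clF M B).card = 3)
    have h2 := card_missedSources_le_choose hG hd' (P := P) S
    omega
  have hfat' : (((missedSources M 5 G P S).filter (fun B => (G \ clF M B).card = 2)).card : ℚ) ≤ 3 := by
    exact_mod_cast hfat
  have hthree' : (((missedSources M 5 G P S).filter (fun B => (G \ clF M B).card = 3)).card : ℚ) ≤
      (((S \ coloops M G).card.choose 2 : ℕ) : ℚ) := by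
    exact_mod_cast hthree
  nlinarith

open scoped Classical in
/-- The off-coloop part of a subset of `G`: `|G ∖ S| + |S ∖ K| = |V|` for `K ⊆ S ⊆ G`. -/
theorem card_sdiff_add_card_sdiff_coloops {S : Finset α}
    (hS : S ∈ shadowAt M (5 + 2) 5 (Uq M (5 + 2) 5) G) :
    (G \ S).card + (S \ coloops M G).card = (G \ coloops M G).card := by
  have hSG : S ⊆ G := subset_G_of_mem_shadowAt hS
  have hKS : coloops M G ⊆ S := coloops_subset_of_mem_shadowAt hS
  rw [← Finset.card_union_of_disjoint]
  · congr 1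
    ext a
    simp only [Finset.mem_union, Finset.mem_sdiff]
    constructor
    · rintro (⟨haG, haS⟩ | ⟨haS, haK⟩)
      · exact ⟨haG, fun haK => haS (hKS haK)⟩
      · exact ⟨hSG haS, haK⟩
    · rintro ⟨haG, haK⟩
      by_cases haS : a ∈ S
      · exact Or.inr ⟨haS, haK⟩
      · exact Or.inl ⟨haG, haS⟩
  · rw [Finset.disjoint_left]; intro a ha hb
    exact (Finset.mem_sdiff.1 ha).2 (Finset.mem_sdiff.1 hb).1

open scoped Classical in
/-- **The top targets (`|S ∖ K| ≥ |V| − 1`) have `cap3 ≥ 1`**: `cap2 = 1` and no source. -/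
theorem one_le_cap3_of_top (hG : G ∈ flatsQ M (5 + 1)) (hd : (gr M \ G).card = 3) (hk : kColoops M G = 2)
    (hs : ∀ e ∈ gr M, ∀ f ∈ gr M, e ≠ f → rkN M {e, f} = 2) (hl : ∀ e ∈ gr M, M.Indep {e})
    {P : Finset α → Prop} [DecidablePred P] (hP : ∀ B, P B → 4 ≤ (B \ coloops M G).card) {S : Finset α}
    (hS : S ∈ shadowAt M (5 + 2) 5 (Uq M (5 + 2) 5) G)
    (htop : (G \ coloops M G).card ≤ (S \ coloops M G).card + 1) :
    1 ≤ cap3 M 5 G P (dshMissed M 5 G) S := by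
  have hGS := card_sdiff_add_card_sdiff_coloops hS
  have hc1 : cap2 M 5 G S = 1 := by
    apply cap2_eq_one_of_card_le hG
    omega
  have hdl0 := dload_missed_eq_zero_of_large hG hd hk hs hl hP (S := S) (by omega)
  unfold cap3
  rw [hc1, hdl0]
  norm_num

open scoped Classical in
/-- **The second level (`|S ∖ K| = |V| − 2`) has `cap3 ≥ 1 − 3/20 − C(|V| − 2, 2)/198`**. -/
theorem cap3_ge_of_second (hG : G ∈ flatsQ M (5 + 1)) (hd : (gr M \ G).card = 3) (hk : kColoops M G = 2)
    (hs : ∀ e ∈ gr M, ∀ f ∈ gr M, e ≠ f → rkN M {e, f} = 2) (hl : ∀ e ∈ gr M, M.Indep {e})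
    (h8 : 8 ≤ (G \ coloops M G).card) {P : Finset α → Prop} [DecidablePred P]
    (hP : ∀ B, P B → 4 ≤ (B \ coloops M G).card) {S : Finset α}
    (hS : S ∈ shadowAt M (5 + 2) 5 (Uq M (5 + 2) 5) G)
    (hsec : (S \ coloops M G).card + 2 = (G \ coloops M G).card) :
    1 - 3 / 20 - ((((G \ coloops M G).card - 2).choose 2 : ℕ) : ℚ) / 198 ≤ cap3 M 5 G P (dshMissed M 5 G) S := by
  have hGS := card_sdiff_add_card_sdiff_coloops hS
  have hc1 : cap2 M 5 G S = 1 := by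
    apply cap2_eq_one_of_card_le hG
    omega
  have hdl := dload_missed_le_of_top hG hd hk hs hl h8 hP S
  have hcard : (S \ coloops M G).card = (G \ coloops M G).card - 2 := by omega
  rw [hcard] at hdl
  unfold cap3
  rw [hc1]
  linarith

end TopCaps

end PercRepro.Shadow
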